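import Literature.NumberTheory.LFunctions.RealZeroVonMangoldtSeriesBoundUpTo
import Literature.NumberTheory.LFunctions.NoRealZeroCertificateReplaySplit
import HarnessLib

/-!
# Kernel replay of the Lu–Zaman–Zhao certificates on the RESTRICTED Theorem 2.1 (`theorem21UpTo Q`)

Topic `Literature/NumberTheory/LFunctions` (namespace `Literature.NumberTheory.LFunctions.LuZamanZhao2026`
and `….Replay`). Everything here is PROVED; no definitions, no named facts.

The certificate decision rule of Lu–Zaman–Zhao (arXiv:2602.03626, §2.1: if (2.5) fails for some row of
Table 1 then `L(σ, χ) ≠ 0` on `[1 − c/log q, 1]`) and the bridges of the kernel replay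
(`NoRealZeroPrimeSumCriterion.lean`, `NoRealZeroDiscriminantCertificate.lean`,
`NoRealZeroCertificateReplay{,Except,Split}.lean`) were stated relative to the printed Theorem 2.1
(`theorem21`, a named fact). They only ever apply it at moduli `q ≤ Q` and at real zeros
`β₁ = σ ∈ [1 − c/log q, 1)`, which lie in `(½, 1)` as soon as `c ≤ ½` (`log q > 1` for `q ≥ 3`). This
file re-runs the same proofs on the restricted hypothesis `theorem21UpTo Q`
(`RealZeroVonMangoldtSeriesBoundUpTo.lean`), which is PROVED for `Q = 4·10⁵`
(`theorem21UpTo_fourHundredThousand`):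

* `lfunction_ne_zero_of_rhs_lt_primeSum_upTo` — the decision rule (`0 < c ≤ ½`);
* `noExceptionalZeroUpTo_of_certificates_upTo`, `noExceptionalZeroUpTo_of_discriminant_certificates_upTo`
  — table forms (character / discriminant certificates);
* `Replay.noExceptionalZeroUpTo_of_certifiedRange_except_upTo`, `Replay.noExceptionalZeroUpTo_of_certifiedRange_upTo`
  — certified ranges with directly settled exceptions / without exceptions;
* `Replay.noExceptionalZeroUpTo_of_light_heavy_upTo` — the LIGHT/HEAVY glue:
  `theorem21UpTo Q → CertifiedRange (1/5) 23 Q L → (∀ D ∈ L, direct D = false → CertifiedAt (1/5) D) →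
   NoExceptionalZeroUpTo Q (1/5)`.

Use: with `Q = 400000`, `L = heavyList15`, the cell's landed `LightRows`/`HeavyRows` theorems and
`theorem21UpTo_fourHundredThousand`, the leaf `NoExceptionalZeroUpTo 400000 (1/5)` becomes an
unconditional kernel theorem (Summits side, route `LZZCertificateReplay`).

## References

* R. F. Lu, A. Zaman, H. Zhao, *Explicit bounds for Dirichlet L-functions: no Siegel zeros for moduli up
  to 10¹⁰*, Math. Comp. (2026), arXiv:2602.03626, Theorem 2.1, (2.2)–(2.5), §2.1–§3. [LuZamanZhao2026]
-/

noncomputable section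

open Complex Finset

namespace Literature.NumberTheory.LFunctions
namespace LuZamanZhao2026

open PrimitiveQuadratic Literature.Barriers.RiemannHypothesis

/-! ### The decision rule on the restricted hypothesis -/

/-- `1 < log q` for `q ≥ 3` (`e < 3`). [folklore] -/
private theorem one_lt_log_of_three_le {q : ℕ} (hq : 3 ≤ q) : 1 < Real.log q := by
  have hq3 : (3 : ℝ) ≤ (q : ℝ) := by exact_mod_cast hq
  rw [Real.lt_log_iff_exp_lt (by linarith)]
  have := Real.exp_one_lt_d9
  linarith

/-- **Soundness of the certificate on the restricted hypothesis.** Assume Theorem 2.1 for the moduli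
`q ≤ Q` and real zeros in `(½, 1)` (`theorem21UpTo Q`). Let `χ` be a primitive quadratic character
mod `3 ≤ q ≤ Q`, `(λ, ϕ, E)` a row of Table 1 (`r = λ/(10 log 10)`, `σ₁ = 1 + r`), `0 < c ≤ ½` and
`N` such that the certificate inequality `rhs c λ ϕ E q < primeSum χ σ₁ N` holds ((2.5) FAILS).
Then `L(σ, χ) ≠ 0` for every real `σ ≤ 1` with `σ ≥ 1 − c/log q` (such `σ` exceed `½` since
`log q > 1`; a zero `β₁ = σ < 1` would give (2.5) by the hypothesis, (2.2)–(2.3) and the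
monotonicity in `β₁`; at `σ = 1`, `L(1, χ) ≠ 0`). [cite: LuZamanZhao2026, Theorem 2.1 and (2.2)–(2.5)] -/
theorem lfunction_ne_zero_of_rhs_lt_primeSum_upTo {Q : ℕ} (h21 : theorem21UpTo Q) {q : ℕ} [NeZero q]
    (hq : 3 ≤ q) (hqQ : q ≤ Q) {χ : DirichletCharacter ℂ q} (hprim : χ.IsPrimitive)
    (hquad : χ.IsQuadratic) {lam phi E : ℝ} (hrow : Table1 lam phi E) {c : ℝ} (hc : 0 < c)
    (hc2 : c ≤ 1 / 2) {N : ℕ} (hcert : rhs c lam phi E q < primeSum χ (1 + rOf lam) N)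
    {σ : ℝ} (hσ : 1 - c / Real.log q ≤ σ) (hσ1 : σ ≤ 1) : χ.LFunction σ ≠ 0 := by
  intro hzero
  have hne : χ ≠ 1 := SiegelZeroQuality.ne_one_of_isPrimitive hprim (by omega)
  rcases eq_or_lt_of_le hσ1 with rfl | hlt
  · exact DirichletCharacter.LFunction_ne_zero_of_one_le_re χ (Or.inl hne) (by simp) hzero
  have hr := (rOf_pos_of_table1 hrow).1
  have hlog1 := one_lt_log_of_three_le hq
  have hlogq : 0 < Real.log q := by linarith
  have hhalf : 1 / 2 < σ := by
    have h1 : (1 : ℝ) / 2 * 1 < 1 / 2 * Real.log q := mul_lt_mul_of_pos_left hlog1 (by norm_num)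
    have h2 : c / Real.log q < 1 / 2 := by rw [div_lt_iff₀ hlogq]; linarith
    linarith
  -- Theorem 2.1 (restricted) at `β₁ = σ`, then (2.2)–(2.3) and the monotonicity: this is (2.5)
  have h1 := h21 q hq hqQ χ hprim σ hhalf hlt hzero lam phi E hrow
  have h2 := primeSum_le_tsum χ hquad (σ := 1 + rOf lam) (by linarith) N
  have h3 := rhs_mono (R := rOf lam + 7 / 8) hr hlogq hc (by linarith) hσ hlt
  have : primeSum χ (1 + rOf lam) N ≤ rhs c lam phi E q := by
    unfold rhs
    linarith
  linarith

/-- **Table form on the restricted hypothesis**: `theorem21UpTo Q`, `0 < c ≤ ½` and a certificate for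
every primitive quadratic `χ` of modulus `3 ≤ q ≤ Q` give `NoExceptionalZeroUpTo Q c`.
[cite: LuZamanZhao2026, Theorem 2.1 and §2.1–§3] -/
theorem noExceptionalZeroUpTo_of_certificates_upTo {Q : ℕ} (h21 : theorem21UpTo Q) {c : ℝ}
    (hc : 0 < c) (hc2 : c ≤ 1 / 2)
    (hcert : ∀ (q : ℕ) [NeZero q], 3 ≤ q → q ≤ Q → ∀ χ : DirichletCharacter ℂ q,
      χ.IsQuadratic → χ.IsPrimitive →
        ∃ lam phi E : ℝ, Table1 lam phi E ∧ ∃ N : ℕ, rhs c lam phi E q < primeSum χ (1 + rOf lam) N) :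
    NoExceptionalZeroUpTo Q c := by
  intro q _ hq3 hqQ χ hquad hprim σ _ hσ hσ1
  obtain ⟨lam, phi, E, hrow, N, hN⟩ := hcert q hq3 hqQ χ hquad hprim
  exact lfunction_ne_zero_of_rhs_lt_primeSum_upTo h21 hq3 hqQ hprim hquad hrow hc hc2 hN hσ hσ1

/-- **Discriminant form on the restricted hypothesis**: `theorem21UpTo Q`, `0 < c ≤ ½`, a base table
`NoExceptionalZeroUpTo Q₀ c` and a discriminant certificate for every fundamental `D` with
`Q₀ < |D| ≤ Q` give `NoExceptionalZeroUpTo Q c`. [cite: LuZamanZhao2026, §2.1–§3] -/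
theorem noExceptionalZeroUpTo_of_discriminant_certificates_upTo {Q : ℕ} (h21 : theorem21UpTo Q)
    {Q₀ : ℕ} {c : ℝ} (hc : 0 < c) (hc2 : c ≤ 1 / 2) (h₀ : NoExceptionalZeroUpTo Q₀ c)
    (hcert : ∀ D : ℤ, IsFundamentalDiscriminant D → (Q₀ : ℤ) < |D| → |D| ≤ (Q : ℤ) →
      ∃ lam phi E : ℝ, Table1 lam phi E ∧
        ∃ N : ℕ, rhs c lam phi E D.natAbs < primeSumD D (1 + rOf lam) N) :
    NoExceptionalZeroUpTo Q c := by
  intro q _ hq3 hqQ χ hquad hprim σ hσ0 hσ hσ1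
  by_cases hq₀ : q ≤ Q₀
  · exact h₀ q hq3 hq₀ χ hquad hprim σ hσ0 hσ hσ1
  have hq₀' : Q₀ < q := lt_of_not_ge hq₀
  have h1 : 1 < q := by omega
  obtain ⟨s, hs1, hs⟩ := exists_sign_eq χ
  have hs1' : s = 1 ∨ s = -1 := by
    rcases hs1 with ⟨h, -⟩ | ⟨h, -⟩
    · exact Or.inl h
    · exact Or.inr h
  have hfd : IsFundamentalDiscriminant (s * q) :=
    isFundamentalDiscriminant_sign_mul hprim hquad hs hs1' h1
  have habs : |(s * q : ℤ)| = q := by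
    rcases hs1' with rfl | rfl <;> simp
  have hnat : (s * q : ℤ).natAbs = q := by
    have := congrArg Int.natAbs habs
    rwa [Int.natAbs_abs, Int.natAbs_natCast] at this
  obtain ⟨lam, phi, E, hrow, N, hN⟩ :=
    hcert (s * q) hfd (by rw [habs]; exact_mod_cast hq₀') (by rw [habs]; exact_mod_cast hqQ)
  rw [hnat, ← primeSum_eq_primeSumD h1 hprim hquad hs hs1' (1 + rOf lam) N] at hN
  exact lfunction_ne_zero_of_rhs_lt_primeSum_upTo h21 hq3 hqQ hprim hquad hrow hc hc2 hN hσ hσ1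

namespace Replay

/-- **The bridge with directly settled exceptions, on the restricted hypothesis** (`theorem21UpTo Q`,
`0 < c ≤ ½`; otherwise as `noExceptionalZeroUpTo_of_certifiedRange_except`). [cite: LuZamanZhao2026, §2.1–§3] -/
theorem noExceptionalZeroUpTo_of_certifiedRange_except_upTo {Q : ℕ} (h21 : theorem21UpTo Q) {c : ℝ}
    (hc : 0 < c) (hc2 : c ≤ 1 / 2) {Q0 : ℕ} (h₀ : NoExceptionalZeroUpTo Q0 c) {X : List ℤ}
    (h : CertifiedRange c Q0 Q X) {Mo Me : List ℕ} (hodd : NoRealZeroOddAt Mo)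
    (heven : NoRealZeroEvenAt Me) (hXo : ∀ D ∈ X, D < 0 → D.natAbs ∈ Mo)
    (hXe : ∀ D ∈ X, 0 < D → D.natAbs ∈ Me) : NoExceptionalZeroUpTo Q c := by
  intro q _ hq3 hqQ χ hquad hprim σ hσ0 hσ hσ1
  by_cases hq₀ : q ≤ Q0
  · exact h₀ q hq3 hq₀ χ hquad hprim σ hσ0 hσ hσ1
  have hq₀' : Q0 < q := lt_of_not_ge hq₀
  have h1 : 1 < q := by omega
  -- at `σ = 1` there is nothing to do
  rcases eq_or_lt_of_le hσ1 with rfl | hlt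
  · have hne : χ ≠ 1 := SiegelZeroQuality.ne_one_of_isPrimitive hprim (by omega)
    exact DirichletCharacter.LFunction_ne_zero_of_one_le_re χ (Or.inl hne) (by simp)
  obtain ⟨s, hs1, hs⟩ := exists_sign_eq χ
  have hs1' : s = 1 ∨ s = -1 := by
    rcases hs1 with ⟨h, -⟩ | ⟨h, -⟩
    · exact Or.inl h
    · exact Or.inr h
  have hfd : IsFundamentalDiscriminant (s * q) :=
    isFundamentalDiscriminant_sign_mul hprim hquad hs hs1' h1
  have habs : |(s * q : ℤ)| = q := by
    rcases hs1' with rfl | rfl <;> simp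
  have hnat : (s * q : ℤ).natAbs = q := by
    have := congrArg Int.natAbs habs
    rwa [Int.natAbs_abs, Int.natAbs_natCast] at this
  by_cases hX : (s * q : ℤ) ∈ X
  · -- a directly settled exception
    rcases hs1 with ⟨rfl, hev⟩ | ⟨rfl, hod⟩
    · have hpos : (0 : ℤ) < 1 * q := by
        have : (0 : ℤ) < q := by exact_mod_cast (show 0 < q by omega)
        simpa using this
      have hmem := hXe _ hX hpos
      rw [hnat] at hmem
      exact heven q hmem χ hquad hprim hev σ hσ0 hlt
    · have hneg : (-1 * q : ℤ) < 0 := by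
        have : (0 : ℤ) < q := by exact_mod_cast (show 0 < q by omega)
        linarith
      have hmem := hXo _ hX hneg
      rw [hnat] at hmem
      exact hodd q hmem χ hquad hprim hod σ hσ0 hlt
  · -- a certified discriminant
    obtain ⟨lam, phi, E, hrow, N, hN⟩ :=
      h (s * q) hfd (by rw [habs]; exact_mod_cast hq₀') (by rw [habs]; exact_mod_cast hqQ) hX
    rw [hnat, ← primeSum_eq_primeSumD h1 hprim hquad hs hs1' (1 + rOf lam) N] at hN
    exact lfunction_ne_zero_of_rhs_lt_primeSum_upTo h21 hq3 hqQ hprim hquad hrow hc hc2 hN hσ hσ1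

/-- **The bridge without exceptions, on the restricted hypothesis.** [cite: LuZamanZhao2026, §2.1–§3] -/
theorem noExceptionalZeroUpTo_of_certifiedRange_upTo {Q : ℕ} (h21 : theorem21UpTo Q) {c : ℝ}
    (hc : 0 < c) (hc2 : c ≤ 1 / 2) {Q0 : ℕ} (h₀ : NoExceptionalZeroUpTo Q0 c)
    (h : CertifiedRange c Q0 Q []) : NoExceptionalZeroUpTo Q c :=
  noExceptionalZeroUpTo_of_discriminant_certificates_upTo h21 hc hc2 h₀ fun D hfd hlo hhi =>
    h D hfd hlo hhi (by simp)

/-- **The LIGHT/HEAVY glue on the restricted hypothesis.** Assume Theorem 2.1 for the moduli `q ≤ Q`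
and real zeros in `(½, 1)` (`theorem21UpTo Q`), a light layer `CertifiedRange (1/5) 23 Q L` and a heavy
layer certifying every `D ∈ L` not settled directly (`direct D = false`). Then
`NoExceptionalZeroUpTo Q (1/5)` (base `noExceptionalZeroUpTo_fiftyTwo`; directly settled members of `L`
via the odd conductors `≤ 163` and the even conductors `≤ 52`). [cite: LuZamanZhao2026, §2.1–§3] -/
theorem noExceptionalZeroUpTo_of_light_heavy_upTo {Q : ℕ} (h21 : theorem21UpTo Q) {L : List ℤ}
    (hl : CertifiedRange (1 / 5) 23 Q L) (hh : ∀ D ∈ L, direct D = false → CertifiedAt (1 / 5) D) :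
    NoExceptionalZeroUpTo Q (1 / 5) := by
  classical
  by_cases hQ : Q ≤ 52
  · exact (noExceptionalZeroUpTo_fiftyTwo (1 / 5)).anti_level hQ
  have hQ' : 52 ≤ Q := by omega
  -- keep only the directly settled exceptions
  set Y : List ℤ := L.filter fun D => direct D with hY
  have hlY : CertifiedRange (1 / 5) 23 Q Y := by
    refine hl.of_except fun D hD hDY => hh D hD ?_
    cases h : direct D
    · rfl
    · exact absurd (List.mem_filter.2 ⟨hD, by simpa using h⟩) hDY
  have hlY' : CertifiedRange (1 / 5) 52 Q Y := hlY.mono (by norm_num) le_rfl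
  refine noExceptionalZeroUpTo_of_certifiedRange_except_upTo h21 (by norm_num) (by norm_num)
    (noExceptionalZeroUpTo_fiftyTwo _) hlY' noRealZeroOddAt_range_onehundredsixtythree
    noRealZeroEvenAt_range_fiftyTwo ?_ ?_
  · intro D hD hD0
    have hd : direct D = true := by
      have := (List.mem_filter.1 hD).2
      simpa using this
    rw [direct_eq_true_iff] at hd
    rw [List.mem_append, List.mem_range', List.mem_range']
    rcases hd with ⟨h3, h52⟩ | ⟨-, h5, h163⟩
    · exact Or.inl ⟨D.natAbs - 3, by omega, by omega⟩
    · by_cases h52 : D.natAbs ≤ 52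
      · exact Or.inl ⟨D.natAbs - 3, by omega, by omega⟩
      · exact Or.inr ⟨D.natAbs - 53, by omega, by omega⟩
  · intro D hD hD0
    have hd : direct D = true := by
      have := (List.mem_filter.1 hD).2
      simpa using this
    rw [direct_eq_true_iff] at hd
    rw [List.mem_range']
    rcases hd with ⟨h3, h52⟩ | ⟨hneg, -, -⟩
    · exact ⟨D.natAbs - 3, by omega, by omega⟩
    · exact absurd hneg (not_lt.2 hD0.le)

end Replay

end LuZamanZhao2026
end Literature.NumberTheory.LFunctions

end
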